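import Summits.BirchSwinnertonDyer.BirchSwinnertonDyer.Theorems.ThetaPartnerAtTwoSignedKatoUpToAtTwoLocalTwoRealLayer
import Summits.BirchSwinnertonDyer.BirchSwinnertonDyer.Theorems.ThetaPartnerAtTwoSignedKatoUpToAtTwoLocalTwoTowerIntersection
import HarnessLib

/-!
# Route `ThetaPartnerAtTwo` (TP2), crux K3 `SignedKatoDivisibilityUpToAtTwo` (item stmt-BirchSwinnertonDyer-20308),
# line `colemanrat` v3 — THE LOCAL THEORY AT `p = 2`, file 14: the SIGN-FLIP DICTIONARY between Kobayashi's signed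
# groups on the `ℤ₂`-tower `ℚ_{2,n} = ℚ₂(ζ_{2^{n+2}})⁺` (Def. 1.1, K3's own object `signedLocalPointsOfEmb κ ι W ε n`) and on
# the μ-tower `K_{n+1,v} = ℚ₂(ζ_{2^{n+2}})` (§2 p. 4, `towerSignedLocalPointsOfEmb U ι W ε (n+1)`):
# **`E^ε(ℚ_{2,n}) = E(ℚ_{2,n}) ∩ E^{−ε}(ℚ₂(ζ_{2^{n+2}}))`**, and Prop. 8.12 ii) (GENERATION) on the `ℤ₂`-tower:
# **`E(ℚ_{2,n}) = E⁺(ℚ_{2,n}) + E⁻(ℚ_{2,n})`** EXACTLY, for every globally minimal `W/ℚ` with `GoodSS W 2`, `a₂(W) = 0` (K3's binders)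

HONEST FRAMING (cell `bsd-wall`, width seat `bsd-wall-tp2-p2x-w2` g2): THEOREMS ONLY — no definition, no named fact, no
instance, no `sorry`; local theory of the signed (`±`) point groups at the prime `2`; nothing about any Selmer group is
asserted; closes no item; BSD is NOT proved by any of this.

## Why this file

Reading Def. 1.1's condition of index `m` («`Tr_{n/m+1} P ∈ E(ℚ_{2,m})`», parity `(−1)^m = ε`) through the real-layer dictionary of
file 13 (`Tr^ℚ_{n/j} = Tr^K_{n+1/j+1}` on `E(ℚ_{2,n})`, `E(ℚ_{2,m}) = E(ℚ_{2,m+1}) ∩ E(K_{m+1,v})`) gives §2's condition of index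
`m' = m + 1` («`Tr_{n+1/m'+1} P ∈ E(K_{m',v})`», parity `(−1)^{m'} = −ε`): the μ-index is the `ℤ₂`-index PLUS ONE, so the PARITY
FLIPS, and §2's edge clauses `m' = 0` (`Tr_{n+1/1} P = Tr_{n/0} P ∈ E(ℚ₂)`) / `m' = −1` (`E(K_{0,v}) = E(ℚ₂)` at `2`) hold for every
`P ∈ E(ℚ_{2,n})`. Hence **`E^ε(ℚ_{2,n}) = E(ℚ_{2,n}) ∩ E^{−ε}(K_{n+1,v})`** (`signedLocalPointsOfEmb_eq_inf_towerSigned_neg_two`). At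
odd `p`, where `ℚ_{p,n} ⊂ K_{n,v}` with the SAME index, there is no shift and no flip; this is the `p = 2` deviation (d1)/(d2) of the
port memo `Cruxes/SignedKatoDivisibilityUpToAtTwo/G2-PORT-AT-2.md` §0 at the level of the signed groups. CONSEQUENCE for K3: the
crux's `ε = 1` (Def. 1.1 over `ℚ_∞`, `SignedSelmerDualData W κ γ 1`) corresponds to Kobayashi's MINUS objects over
`K_∞ = ℚ(μ_{2^∞})`; any `K_∞`-level statement of the 2-adic Coleman/Poitou–Tate package (the promoted (C2) item) feeding the
`Δ = {±1}`-descent road (`…OffTwoDeltaDescent`, p579683) must carry the flipped sign.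
With the lead's Prop. 8.12 ii) generation half along `ℚ₂(μ_{2^∞})` (files 7/10: `E(K_{n+1,v}) = E⁺(K_{n+1,v}) + E⁻(K_{n+1,v})`)
and the directness half (file 12: `E⁺(K_{n+1,v}) ∩ E⁻(K_{n+1,v}) = E(ℚ₂)`), the dictionary yields Prop. 8.12 ii) (GENERATION) FOR DEF. 1.1's
OWN GROUPS on the `ℤ₂`-tower, EXACTLY and with NO point construction on `ℚ_{2,n}`: write `P ∈ E(ℚ_{2,n})` as `P = A + B`,
`A ∈ E⁺(K_{n+1,v})`, `B ∈ E⁻(K_{n+1,v})`, and let `σ₀` be complex conjugation; `Q := A − σ₀A = σ₀B − B ∈ E⁺ ∩ E⁻ = E(ℚ₂)` is fixed by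
`σ₀`, while `σ₀Q = σ₀A − σ₀²A = −Q` (`σ₀² ∈ Stab ζ_{2^{n+2}}`), so `2Q = 0`, `Q = 0` (Prop. 8.7 at `2`): BOTH SUMMANDS ARE REAL, hence
`A ∈ E(ℚ_{2,n}) ∩ E⁺(K_{n+1,v}) = E⁻(ℚ_{2,n})`, `B ∈ E⁺(ℚ_{2,n})`, and **`E(ℚ_{2,n}) = E⁺(ℚ_{2,n}) + E⁻(ℚ_{2,n})`**
(`sup_signedLocalPointsOfEmb_eq_localLayerPointsOfEmb_two[_cyclotomic]`) for every globally minimal `W/ℚ` with `GoodSS W 2`, `a₂(W) = 0`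
— residue (b) of the port memo, the `ℤ₂`-tower `±`-decomposition that the 2-adic Coleman/Poitou–Tate package for K3's pinned
`SignedSelmerDualData W κ γ 1` needs. Together with file 11 (`E⁺(ℚ_{2,n}) ∩ E⁻(ℚ_{2,n}) = E(ℚ₂)`, width seat `w3` g2) this is Kobayashi's
exact sequence (8.22) `0 → E(ℚ₂) → E⁺(ℚ_{2,n}) ⊕ E⁻(ℚ_{2,n}) → E(ℚ_{2,n}) → 0` AT `p = 2` on the crux's own local objects.

## What is proved (`κ : ZpExtension ℚ 2` CYCLOTOMIC, `ι : ℚ̄ → ℚ̄₂`, `U : ℕ → Subgroup Γ_ℚ` with local subgroups `(U k)_ι = Stab ζ_{2^{k+1}}`)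

* §1 **`signedLocalPointsOfEmb_eq_inf_towerSigned_neg_two`**: `E^ε(ℚ_{2,n}) = E(ℚ_{2,n}) ⊓ E^{−ε}(K_{n+1,v})` (any `W/ℚ`, any sign,
  any `n`); `signedLocalPointsOfEmb_one_eq_inf_towerSigned_neg_one_two` (the two spellings).
* §2 `smul_eq_self_of_add_eq_of_mem_towerSigned_two` (a `±`-summand of a real point is real; `GoodSS W 2` only),
  `mem_localLayerPointsOfEmb_of_smul_eq_self_two`, **`localLayerPointsOfEmb_le_sup_signedLocalPointsOfEmb_two`** /
  **`sup_signedLocalPointsOfEmb_eq_localLayerPointsOfEmb_two`** (`W/ℚ` globally minimal, `GoodSS W 2`, `a₂(W) = 0`, `U` antitone normal of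
  finite index with local stabilisers): `E⁺(ℚ_{2,n}) ⊔ E⁻(ℚ_{2,n}) = E(ℚ_{2,n})`; `…_cyclotomic`: the same along Kobayashi's own tower
  `U k = Gal(ℚ̄/ℚ(ζ_{2^{k+1}}))` (file 10), i.e. with NO hypothesis beyond K3's binders and `κ` cyclotomic (the tower no longer appears).

References: [Kobayashi2003] S. Kobayashi, Invent. Math. 152 (2003), Def. 1.1 (p. 2), §2 p. 4, Prop. 8.12 ii) and (8.22) (p. 17);
[Washington1997] §13.1; [KuriharaOtsuki2006] p. 557; [Sprung2012] p. 1487.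
-/

set_option autoImplicit false
-- the Theorems namespace of this sub repeats the summit name by design (D-0017 nested layout)
set_option linter.dupNamespace false

noncomputable section

open scoped Classical

universe u

namespace Summit.BirchSwinnertonDyer.BirchSwinnertonDyer.Theorems

namespace SignedKatoOffTwo.LocalTwo

open Literature.NumberTheory.EllipticCurves Literature.NumberTheory.GaloisRepresentations WeierstrassCurve Field
open Summit.BirchSwinnertonDyer.Rank1Residual.Additive
open Summit.BirchSwinnertonDyer.Rank1Residual.Additive.PadicCyclotomicTower
open Literature.NumberTheory.EllipticCurves.Rank1Residual ZpExtension

/-! ## §1 The sign-flip dictionary `E^ε(ℚ_{2,n}) = E(ℚ_{2,n}) ∩ E^{−ε}(K_{n+1,v})` -/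

section SignFlip

variable {κ : ZpExtension ℚ 2} (ι : AlgebraicClosure ℚ →ₐ[ℚ] AlgebraicClosure ℚ_[2]) (W : WeierstrassCurve ℚ)
  {U : ℕ → Subgroup (absoluteGaloisGroup ℚ)} [hUf : ∀ k, (U k).FiniteIndex]

/-- **THE SIGN-FLIP DICTIONARY AT `p = 2`.** For the cyclotomic `ℤ₂`-extension `κ` of `ℚ`, any `ι : ℚ̄ → ℚ̄₂`, any `W/ℚ`, any tower
`U` of finite-index subgroups of `Γ_ℚ` with local subgroups `(U k)_ι = Stab ζ_{2^{k+1}}` (`K_{k,v} = ℚ₂(ζ_{2^{k+1}})`), every sign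
`ε` and every `n`:
**`signedLocalPointsOfEmb κ ι W ε n = localLayerPointsOfEmb κ ι W n ⊓ towerSignedLocalPointsOfEmb U ι W (−ε) (n+1)`**, i.e.
`E^ε(ℚ_{2,n}) = E(ℚ_{2,n}) ∩ E^{−ε}(ℚ₂(ζ_{2^{n+2}}))` — Def. 1.1's condition of index `m` is §2's condition of index `m + 1` (the
traces agree on `E(ℚ_{2,n})` and `E(ℚ_{2,m}) = E(ℚ_{2,m+1}) ∩ E(K_{m+1,v})`), the parity flips, and §2's clauses `m' = 0`
(`Tr_{n+1/1} P = Tr_{n/0} P ∈ E(ℚ₂)`) and `m' = −1` (`E(K_{0,v}) = E(ℚ₂)` at `2`) hold for every `P ∈ E(ℚ_{2,n})`.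
[cite: Kobayashi2003, Def. 1.1 (p. 2) and §2 p. 4] [cite: Washington1997, §13.1] [cite: Sprung2012, p. 1487] -/
theorem signedLocalPointsOfEmb_eq_inf_towerSigned_neg_two (hκ : κ.IsCyclotomic)
    (hU : ∀ k, localSubgroupOfEmb (U k) ι = stab 2 (k + 1)) (ε : ℤˣ) (n : ℕ) :
    Kobayashi2003.signedLocalPointsOfEmb κ ι W ε n =
      Kobayashi2003.localLayerPointsOfEmb κ ι W n ⊓ towerSignedLocalPointsOfEmb U ι W (-ε) (n + 1) := by
  ext P
  constructor
  · intro hP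
    have hPn : P ∈ Kobayashi2003.localLayerPointsOfEmb κ ι W n := Kobayashi2003.signedLocalPointsOfEmb_le κ ι W ε n hP
    refine AddSubgroup.mem_inf.mpr ⟨hPn, ?_⟩
    rw [mem_towerSignedLocalPointsOfEmb_iff]
    refine ⟨localLayerPointsOfEmb_le_localFixedPointsOfEmb_succ_two ι W hκ hU n hPn, fun j hj hjε => ?_, fun _ => ?_⟩
    · rw [← localTraceOfEmb_eq_localPairTraceOfEmb_two ι W hκ hU (Nat.lt_succ_iff.mp hj) hPn]
      rcases j with _ | m
      · exact localLayerPointsOfEmb_zero_le_localFixedPointsOfEmb ι W (U 0)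
          (Kobayashi2003.localTraceOfEmb_mem_of_mem κ ι W 0 n hPn)
      · have hmε : (m : ℤ).negOnePow = ε := by
          rwa [Nat.cast_succ, Int.negOnePow_succ, neg_inj] at hjε
        exact localLayerPointsOfEmb_le_localFixedPointsOfEmb_succ_two ι W hκ hU m
          (hP.2 m (by omega) hmε)
    · exact (localFixedPointsOfEmb_zero_eq_top_two ι W hU).le
        (localPairTraceOfEmb_mem_of_mem ι W (localLayerPointsOfEmb_le_localFixedPointsOfEmb_succ_two ι W hκ hU n hPn))
  · intro h
    obtain ⟨hPn, hT⟩ := AddSubgroup.mem_inf.mp h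
    obtain ⟨-, hTsgn, -⟩ := (mem_towerSignedLocalPointsOfEmb_iff U ι W (-ε) (n + 1) P).mp hT
    refine ⟨hPn, fun m hm hmε => ?_⟩
    have hjε : ((m + 1 : ℕ) : ℤ).negOnePow = -ε := by
      rw [Nat.cast_succ, Int.negOnePow_succ, hmε]
    have h1 := hTsgn (m + 1) (by omega) hjε
    rw [← localTraceOfEmb_eq_localPairTraceOfEmb_two ι W hκ hU (by omega : m + 1 ≤ n) hPn] at h1
    rw [localLayerPointsOfEmb_eq_inf_succ_two ι W hκ hU m]
    exact ⟨Kobayashi2003.localTraceOfEmb_mem_of_mem κ ι W (m + 1) n hPn, h1⟩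

/-- Sign-flip, the two spellings: `E⁺(ℚ_{2,n}) = E(ℚ_{2,n}) ∩ E⁻(K_{n+1,v})` and `E⁻(ℚ_{2,n}) = E(ℚ_{2,n}) ∩ E⁺(K_{n+1,v})`.
[cite: Kobayashi2003, Def. 1.1 (p. 2) and §2 p. 4] -/
theorem signedLocalPointsOfEmb_one_eq_inf_towerSigned_neg_one_two (hκ : κ.IsCyclotomic)
    (hU : ∀ k, localSubgroupOfEmb (U k) ι = stab 2 (k + 1)) (n : ℕ) :
    Kobayashi2003.signedLocalPointsOfEmb κ ι W 1 n =
        Kobayashi2003.localLayerPointsOfEmb κ ι W n ⊓ towerSignedLocalPointsOfEmb U ι W (-1) (n + 1) ∧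
      Kobayashi2003.signedLocalPointsOfEmb κ ι W (-1) n =
        Kobayashi2003.localLayerPointsOfEmb κ ι W n ⊓ towerSignedLocalPointsOfEmb U ι W 1 (n + 1) := by
  refine ⟨signedLocalPointsOfEmb_eq_inf_towerSigned_neg_two ι W hκ hU 1 n, ?_⟩
  have h := signedLocalPointsOfEmb_eq_inf_towerSigned_neg_two ι W hκ hU (-1) n
  rwa [neg_neg] at h

end SignFlip

/-! ## §2 EXACT `±`-decomposition on the `ℤ₂`-tower: `E(ℚ_{2,n}) = E⁺(ℚ_{2,n}) + E⁻(ℚ_{2,n})` (Prop. 8.12 ii) for Def. 1.1) -/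

section Generation

variable {κ : ZpExtension ℚ 2} (ι : AlgebraicClosure ℚ →ₐ[ℚ] AlgebraicClosure ℚ_[2]) (W : WeierstrassCurve ℚ)
  [W.IsGloballyMinimal]
  {U : ℕ → Subgroup (absoluteGaloisGroup ℚ)} [hUf : ∀ k, (U k).FiniteIndex] [hUN : ∀ k, (U k).Normal]

/-- **A `±`-summand of a real point is real** (the key step). Let `P ∈ E(ℚ_{2,n})`, `P = A + B` with `A ∈ E⁺(K_{n+1,v})`,
`B ∈ E⁻(K_{n+1,v})`, and `σ₀` an inverter of `ζ_{2^{n+2}}` (complex conjugation of `K_{n+1,v}/ℚ_{2,n}`). Then `σ₀A = A`: the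
element `Q = A − σ₀A = σ₀B − B` lies in `E⁺(K_{n+1,v}) ∩ E⁻(K_{n+1,v}) = E(ℚ₂)` (directness along the μ-tower at `2`, file 12), so
`σ₀Q = Q`; but `σ₀Q = σ₀A − σ₀²A = σ₀A − A = −Q` (`σ₀² ∈ Stab ζ_{2^{n+2}}`), whence `2Q = 0` and `Q = 0` (no `2`-torsion in
`E(K_{n+1,v})`, Prop. 8.7 at `2`). `W/ℚ` globally minimal with `GoodSS W 2`; no `a₂ = 0` needed here.
[cite: Kobayashi2003, Prop. 8.12 ii) (p. 17), Prop. 8.7 (p. 16)] [cite: Washington1997, §13.1] -/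
theorem smul_eq_self_of_add_eq_of_mem_towerSigned_two (hss : GoodSS W 2) (hκ : κ.IsCyclotomic)
    (hU : ∀ k, localSubgroupOfEmb (U k) ι = stab 2 (k + 1)) (n : ℕ) {σ₀ : absoluteGaloisGroup ℚ_[2]}
    (hσ₀ : σ₀ • zeta 2 (n + 2) = (zeta 2 (n + 2))⁻¹) {P A B : localPoints W ℚ_[2]}
    (hP : P ∈ Kobayashi2003.localLayerPointsOfEmb κ ι W n) (hA : A ∈ towerSignedLocalPointsOfEmb U ι W 1 (n + 1))
    (hB : B ∈ towerSignedLocalPointsOfEmb U ι W (-1) (n + 1)) (hAB : A + B = P) : σ₀ • A = A := by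
  have hσP : σ₀ • P = P := (Kobayashi2003.mem_localLayerPointsOfEmb_iff κ ι W n P).mp hP σ₀
    (mem_localLayerSubgroupOfEmb_of_smul_zeta_eq_inv ι hκ hσ₀ le_rfl)
  have hσA : σ₀ • A ∈ towerSignedLocalPointsOfEmb U ι W 1 (n + 1) :=
    smul_mem_towerSignedLocalPointsOfEmb U ι W 1 (n + 1) σ₀ hA
  have hσB : σ₀ • B ∈ towerSignedLocalPointsOfEmb U ι W (-1) (n + 1) :=
    smul_mem_towerSignedLocalPointsOfEmb U ι W (-1) (n + 1) σ₀ hB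
  -- `Q = A − σ₀A = σ₀B − B ∈ E⁺ ∩ E⁻ = E(ℚ₂)`
  have hQ : A - σ₀ • A = σ₀ • B - B := by
    have h := hσP
    rw [← hAB, smul_add] at h
    rw [sub_eq_sub_iff_add_eq_add, add_comm (σ₀ • B), h]
  have hQtop : A - σ₀ • A ∈ localFixedPointsOfEmb ι W ⊤ := by
    have h2 : σ₀ • B - B ∈ towerSignedLocalPointsOfEmb U ι W (-1) (n + 1) := sub_mem hσB hB
    rw [← hQ] at h2
    rw [← inf_towerSigned_eq_localFixedPointsOfEmb_top_two_of_stab W ι hss hU (n + 1)]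
    exact AddSubgroup.mem_inf.mpr ⟨sub_mem hA hσA, h2⟩
  have hfixQ : σ₀ • (A - σ₀ • A) = A - σ₀ • A := (mem_localFixedPointsOfEmb_top_iff ι W _).mp hQtop σ₀
  -- `σ₀² A = A`
  have hAK : A ∈ localFixedPointsOfEmb ι W (U (n + 1)) := towerSignedLocalPointsOfEmb_le U ι W 1 (n + 1) hA
  have hAfix : ∀ τ ∈ stab 2 (n + 1 + 1), τ • A = A := fun τ hτ =>
    (mem_localFixedPointsOfEmb_iff ι W (U (n + 1)) A).mp hAK τ (by rw [hU]; exact hτ)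
  have hσσA : σ₀ • σ₀ • A = A := by rw [← mul_smul, hAfix _ (mul_self_mem_stab_of_smul_zeta_eq_inv hσ₀)]
  -- `2Q = 0`
  have h2Q : 2 ^ 1 • (A - σ₀ • A) = 0 := by
    rw [smul_sub, hσσA] at hfixQ
    rw [pow_one, two_nsmul]
    nth_rw 1 [← hfixQ]
    rw [sub_add_sub_cancel, sub_self]
  have hQ0 : A - σ₀ • A = 0 :=
    eq_zero_of_two_pow_smul_eq_zero_localFixedPointsOfEmb_of_stab W ι hss hU (n + 1)
      (sub_mem hAK (towerSignedLocalPointsOfEmb_le U ι W 1 (n + 1) hσA)) h2Q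
  exact (sub_eq_zero.mp hQ0).symm

omit [W.IsGloballyMinimal] hUf hUN in
/-- A point of `E(K_{n+1,v})` fixed by complex conjugation `σ₀` is REAL: it lies in `E(ℚ_{2,n})`
(`Gal(ℚ̄₂/ℚ_{2,n}) = Stab ζ_{2^{n+2}} ∪ σ₀·Stab ζ_{2^{n+2}}`). [cite: Washington1997, §13.1] [cite: Kobayashi2003, Def. 1.1] -/
theorem mem_localLayerPointsOfEmb_of_smul_eq_self_two (hκ : κ.IsCyclotomic)
    (hU : ∀ k, localSubgroupOfEmb (U k) ι = stab 2 (k + 1)) (n : ℕ) {σ₀ : absoluteGaloisGroup ℚ_[2]}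
    (hσ₀ : σ₀ • zeta 2 (n + 2) = (zeta 2 (n + 2))⁻¹) {A : localPoints W ℚ_[2]}
    (hA : A ∈ localFixedPointsOfEmb ι W (U (n + 1))) (hσA : σ₀ • A = A) :
    A ∈ Kobayashi2003.localLayerPointsOfEmb κ ι W n := by
  have hAfix : ∀ τ ∈ stab 2 (n + 1 + 1), τ • A = A := fun τ hτ =>
    (mem_localFixedPointsOfEmb_iff ι W (U (n + 1)) A).mp hA τ (by rw [hU]; exact hτ)
  refine (Kobayashi2003.mem_localLayerPointsOfEmb_iff κ ι W n A).mpr fun τ hτ => ?_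
  rcases mem_stab_or_mem_stab_of_mem_localLayer ι hκ hσ₀ le_rfl hτ with h | ⟨-, h⟩
  · exact hAfix τ h
  · calc τ • A = (σ₀ * (σ₀⁻¹ * τ)) • A := by rw [mul_inv_cancel_left]
      _ = σ₀ • (σ₀⁻¹ * τ) • A := mul_smul _ _ _
      _ = A := by rw [hAfix _ h, hσA]

variable [W.IsElliptic]

/-- **KOBAYASHI's Prop. 8.12 ii) (GENERATION) ON THE `ℤ₂`-TOWER AT `p = 2`, for Def. 1.1's own groups**: for `W/ℚ` globally
minimal with `GoodSS W 2` and `a₂(W) = 0`, the cyclotomic `κ`, any `ι`, any antitone tower `U` of normal finite-index subgroups of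
`Γ_ℚ` with local subgroups `Stab ζ_{2^{k+1}}`, and every `n`: **`E(ℚ_{2,n}) ≤ E⁺(ℚ_{2,n}) ⊔ E⁻(ℚ_{2,n})`**. Proof: `P ∈ E(ℚ_{2,n}) ⊆
E(K_{n+1,v}) = E⁺(K_{n+1,v}) + E⁻(K_{n+1,v})` (generation along the μ-tower at `2`: file 7 on file 6's model), `P = A + B`; both
summands are real (`smul_eq_self_of_add_eq_of_mem_towerSigned_two`), hence `A ∈ E(ℚ_{2,n}) ∩ E⁺(K_{n+1,v}) = E⁻(ℚ_{2,n})` and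
`B ∈ E(ℚ_{2,n}) ∩ E⁻(K_{n+1,v}) = E⁺(ℚ_{2,n})` by the sign-flip dictionary. NO point construction on the `ℤ₂`-tower is used.
[cite: Kobayashi2003, Prop. 8.12 ii) and (8.22) (p. 17), Def. 1.1 (p. 2)] [cite: KuriharaOtsuki2006, p. 557] -/
theorem localLayerPointsOfEmb_le_sup_signedLocalPointsOfEmb_two (hss : GoodSS W 2) (ha : W.frobeniusTrace 2 = 0)
    (hκ : κ.IsCyclotomic) (hUa : Antitone U) (hU : ∀ k, localSubgroupOfEmb (U k) ι = stab 2 (k + 1)) (n : ℕ) :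
    Kobayashi2003.localLayerPointsOfEmb κ ι W n ≤
      Kobayashi2003.signedLocalPointsOfEmb κ ι W 1 n ⊔ Kobayashi2003.signedLocalPointsOfEmb κ ι W (-1) n := by
  intro P hP
  -- Prop. 8.12 ii) (generation half) at `2` along the μ-tower, on the `2`-adic model of `W`
  haveI := isElliptic_coe_twoAdicModel W
  haveI := isElliptic_toZMod_twoAdicModel W hss.1
  have htr : Literature.NumberTheory.EllipticCurves.HasseManin.tr
      (((integralModelInt W).map (Int.castRingHom ℤ_[2])).map PadicInt.toZMod) = 0 := by
    rw [tr_twoAdicModel W hss.1, ha]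
  have hgen := sup_towerSigned_eq_localFixedPointsOfEmb_two_of_stab (U := U) (ι := ι) (W := W)
    (a₁_twoAdicModel_mem W hss) htr hUa hU (baseChange_twoAdicModel W) (n + 1)
  have hPK : P ∈ localFixedPointsOfEmb ι W (U (n + 1)) :=
    localLayerPointsOfEmb_le_localFixedPointsOfEmb_succ_two ι W hκ hU n hP
  rw [← hgen] at hPK
  obtain ⟨A, hA, B, hB, hAB⟩ := AddSubgroup.mem_sup.mp hPK
  obtain ⟨σ₀, hσ₀⟩ := exists_smul_zeta_eq_inv (p := 2) (m := n + 2) (by omega)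
  -- both summands are real
  have hσA : σ₀ • A = A := smul_eq_self_of_add_eq_of_mem_towerSigned_two ι W hss hκ hU n hσ₀ hP hA hB hAB
  have hAL : A ∈ Kobayashi2003.localLayerPointsOfEmb κ ι W n :=
    mem_localLayerPointsOfEmb_of_smul_eq_self_two ι W hκ hU n hσ₀ (towerSignedLocalPointsOfEmb_le U ι W 1 (n + 1) hA) hσA
  have hBL : B ∈ Kobayashi2003.localLayerPointsOfEmb κ ι W n := by
    have h := sub_mem hP hAL
    rwa [← hAB, add_sub_cancel_left] at h
  -- sign flip
  have hA' : A ∈ Kobayashi2003.signedLocalPointsOfEmb κ ι W (-1) n := by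
    rw [(signedLocalPointsOfEmb_one_eq_inf_towerSigned_neg_one_two ι W hκ hU n).2]
    exact ⟨hAL, hA⟩
  have hB' : B ∈ Kobayashi2003.signedLocalPointsOfEmb κ ι W 1 n := by
    rw [(signedLocalPointsOfEmb_one_eq_inf_towerSigned_neg_one_two ι W hκ hU n).1]
    exact ⟨hBL, hB⟩
  rw [← hAB]
  exact add_mem (AddSubgroup.mem_sup_right hA') (AddSubgroup.mem_sup_left hB')

/-- The same as an EQUALITY: **`E⁺(ℚ_{2,n}) ⊔ E⁻(ℚ_{2,n}) = E(ℚ_{2,n})`** (`E^± ≤ E` trivially).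
[cite: Kobayashi2003, Prop. 8.12 ii) (p. 17), Def. 1.1 (p. 2)] -/
theorem sup_signedLocalPointsOfEmb_eq_localLayerPointsOfEmb_two (hss : GoodSS W 2) (ha : W.frobeniusTrace 2 = 0)
    (hκ : κ.IsCyclotomic) (hUa : Antitone U) (hU : ∀ k, localSubgroupOfEmb (U k) ι = stab 2 (k + 1)) (n : ℕ) :
    Kobayashi2003.signedLocalPointsOfEmb κ ι W 1 n ⊔ Kobayashi2003.signedLocalPointsOfEmb κ ι W (-1) n =
      Kobayashi2003.localLayerPointsOfEmb κ ι W n :=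
  le_antisymm (sup_le (Kobayashi2003.signedLocalPointsOfEmb_le κ ι W 1 n) (Kobayashi2003.signedLocalPointsOfEmb_le κ ι W (-1) n))
    (localLayerPointsOfEmb_le_sup_signedLocalPointsOfEmb_two ι W hss ha hκ hUa hU n)

/-- **Prop. 8.12 ii) (generation) on the `ℤ₂`-tower with NO hypothesis beyond K3's binders** (`W/ℚ` globally minimal, `GoodSS W 2`,
`a₂(W) = 0`, `κ` THE cyclotomic `ℤ₂`-extension, any `ι`, any `n`): **`E⁺(ℚ_{2,n}) ⊔ E⁻(ℚ_{2,n}) = E(ℚ_{2,n})`** for Def. 1.1's groups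
`signedLocalPointsOfEmb κ ι W (±1) n` — the tower is Kobayashi's own `U k = Gal(ℚ̄/ℚ(ζ_{2^{k+1}}))` (stabilisers of any family
`z k ∈ ℚ̄` of primitive `2^{k+1}`-th roots; file 10's `localSubgroupOfEmb_stabilizer_eq_stab`), which no longer appears in the
statement. With file 11's `E⁺(ℚ_{2,n}) ∩ E⁻(ℚ_{2,n}) = E(ℚ₂)` this is the exact sequence (8.22)
`0 → E(ℚ₂) → E⁺(ℚ_{2,n}) ⊕ E⁻(ℚ_{2,n}) → E(ℚ_{2,n}) → 0` AT `p = 2` for the crux's own local objects.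
[cite: Kobayashi2003, Prop. 8.12 ii) and (8.22) (p. 17), Def. 1.1 (p. 2)] [cite: KuriharaOtsuki2006, p. 557] -/
theorem sup_signedLocalPointsOfEmb_eq_localLayerPointsOfEmb_two_cyclotomic (hss : GoodSS W 2) (ha : W.frobeniusTrace 2 = 0)
    (hκ : κ.IsCyclotomic) (n : ℕ) :
    Kobayashi2003.signedLocalPointsOfEmb κ ι W 1 n ⊔ Kobayashi2003.signedLocalPointsOfEmb κ ι W (-1) n =
      Kobayashi2003.localLayerPointsOfEmb κ ι W n := by
  -- a compatible choice is not needed: any family of primitive `2^{k+1}`-th roots of unity in `ℚ̄`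
  have hex : ∀ k : ℕ, ∃ z : AlgebraicClosure ℚ, IsPrimitiveRoot z (2 ^ (k + 1)) := fun k => by
    haveI : NeZero (2 ^ (k + 1)) := ⟨pow_ne_zero _ two_ne_zero⟩
    exact HasEnoughRootsOfUnity.exists_primitiveRoot (AlgebraicClosure ℚ) (2 ^ (k + 1))
  choose z hz using hex
  haveI : ∀ k, (MulAction.stabilizer (absoluteGaloisGroup ℚ) (z k)).FiniteIndex := fun k => by
    haveI : NeZero (2 ^ (k + 1)) := ⟨pow_ne_zero _ two_ne_zero⟩
    exact stabilizer_primitiveRoot_finiteIndex (hz k)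
  haveI : ∀ k, (MulAction.stabilizer (absoluteGaloisGroup ℚ) (z k)).Normal := fun k => by
    haveI : NeZero (2 ^ (k + 1)) := ⟨pow_ne_zero _ two_ne_zero⟩
    exact stabilizer_primitiveRoot_normal (hz k)
  exact sup_signedLocalPointsOfEmb_eq_localLayerPointsOfEmb_two ι W (U := fun k => MulAction.stabilizer (absoluteGaloisGroup ℚ) (z k))
    hss ha hκ (stabilizer_primitiveRoot_antitone 2 hz) (fun k => localSubgroupOfEmb_stabilizer_eq_stab 2 ι (hz k)) n

end Generation

end SignedKatoOffTwo.LocalTwo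

end Summit.BirchSwinnertonDyer.BirchSwinnertonDyer.Theorems

end
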